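import Mathlib
import Summits.MatrixMultiplication.MatrixMultiplication.Theses.MatrixPointInterpolation

/-!
# `MatrixPointInterpolation.LongMasquerade` (stmt-MatrixMultiplication-18938) — Negative lane, part 1:
# lemmas for the windowed Kaplansky theorem at point size `k = 2`

Helper lemmas (no Theses statement is asserted positively) for `WindowedKaplanskyTwo.lean`, which proves
that the `k = 2` instance of `LongMasquerade` is false.  Contents: generation bookkeeping
(`scalar_of_commute_gens`, `false_of_commute`, `false_of_eigen`), the window in `Finsupp` form
(`masq_finsupp`), Hall's central polynomial of `M₂` and its level-one window consequence
(`commutator_sq_two`, `hall_central_two`, `hall_window`), and the coordinate form of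
`M_n ⊗ M_nᵒᵖ ≅ End M_n` used to read off tensor identities (`sandwich_single_apply`, `tensor_vanish4`).
See the module docstring of `WindowedKaplanskyTwo.lean` for the argument.
-/

namespace Summit.MatrixMultiplication.MatrixMultiplication.Theorems

open scoped BigOperators
open Matrix

namespace LongMasqueradeNeg

variable {n d : ℕ} {A : Fin 2 → Matrix (Fin n) (Fin n) ℂ}

/-- Anything commuting with both generators commutes with `M_n`, hence is scalar. [folklore] -/
theorem scalar_of_commute_gens
    (hspan : Submodule.span ℂ {M : Matrix (Fin n) (Fin n) ℂ |
      ∃ w : List (Fin 2), w.length ≤ d ∧ (w.map A).prod = M} = ⊤)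
    {Z : Matrix (Fin n) (Fin n) ℂ} (hZ : ∀ i, Z * A i = A i * Z) : ∃ s : ℂ, Z = s • 1 := by
  have hall : ∀ X : Matrix (Fin n) (Fin n) ℂ, Z * X = X * Z := by
    intro X
    have hX : X ∈ Submodule.span ℂ {M : Matrix (Fin n) (Fin n) ℂ |
        ∃ w : List (Fin 2), w.length ≤ d ∧ (w.map A).prod = M} := by
      rw [hspan]; exact Submodule.mem_top
    induction hX using Submodule.span_induction with
    | mem X hX =>
      obtain ⟨w, -, rfl⟩ := hX
      induction w with
      | nil => simp
      | cons x w ih =>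
        simp only [List.map_cons, List.prod_cons]
        rw [← Matrix.mul_assoc, hZ x, Matrix.mul_assoc, ih, ← Matrix.mul_assoc]
    | zero => simp
    | add X Y _ _ hX hY => rw [Matrix.mul_add, Matrix.add_mul, hX, hY]
    | smul r X _ hX => rw [Matrix.mul_smul, Matrix.smul_mul, hX]
  obtain ⟨s, hs⟩ :=
    Matrix.mem_range_scalar_of_commute_single (M := Z) fun i j _ => (hall _).symm
  exact ⟨s, by rw [← hs, Matrix.scalar_apply, Matrix.smul_one_eq_diagonal]⟩

/-- Commuting generators do not generate `M_n`, `n ≥ 2`. [folklore] -/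
theorem false_of_commute (hn : 2 ≤ n)
    (hspan : Submodule.span ℂ {M : Matrix (Fin n) (Fin n) ℂ |
      ∃ w : List (Fin 2), w.length ≤ d ∧ (w.map A).prod = M} = ⊤)
    (hcomm : A 0 * A 1 = A 1 * A 0) : False := by
  obtain ⟨s0, hs0⟩ := scalar_of_commute_gens hspan (Z := A 0)
    (Fin.forall_fin_two.2 ⟨rfl, hcomm⟩)
  obtain ⟨s1, hs1⟩ := scalar_of_commute_gens hspan (Z := A 1)
    (Fin.forall_fin_two.2 ⟨hcomm.symm, rfl⟩)
  have h01 : (⟨0, by omega⟩ : Fin n) ≠ ⟨1, by omega⟩ := by simp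
  obtain ⟨s, hs⟩ := scalar_of_commute_gens hspan
    (Z := Matrix.single (⟨0, by omega⟩ : Fin n) (⟨1, by omega⟩ : Fin n) (1 : ℂ))
    (Fin.forall_fin_two.2
      ⟨by rw [hs0, Matrix.mul_smul, Matrix.smul_mul, Matrix.mul_one, Matrix.one_mul],
       by rw [hs1, Matrix.mul_smul, Matrix.smul_mul, Matrix.mul_one, Matrix.one_mul]⟩)
  have := congrFun (congrFun hs ⟨0, by omega⟩) ⟨1, by omega⟩
  simp [h01] at this

/-- `[b,c] = β c` with `β ≠ 0`, `c ≠ 0` and `a ∈ span{1,c}`: then `ker c` is a common invariant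
subspace of `a, b`, so they do not generate `M_n`. [folklore] -/
theorem false_of_eigen
    (hspan : Submodule.span ℂ {M : Matrix (Fin n) (Fin n) ℂ |
      ∃ w : List (Fin 2), w.length ≤ d ∧ (w.map A).prod = M} = ⊤)
    {c : Matrix (Fin n) (Fin n) ℂ} (hc : c ≠ 0) {β : ℂ} (hβ : β ≠ 0)
    (hbc : A 1 * c - c * A 1 = β • c) {α' β' : ℂ} (ha : A 0 = α' • 1 + β' • c) : False := by
  have hn : n ≠ 0 := by
    rintro rfl
    exact hc (Subsingleton.elim _ _)
  have h2 : c * A 1 = A 1 * c - β • c := by rw [← hbc]; abel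
  -- (i) `c` is singular (trace argument)
  have hdet : c.det = 0 := by
    by_contra hdet
    have hu : IsUnit c.det := isUnit_iff_ne_zero.2 hdet
    have key : A 1 = c * A 1 * c⁻¹ + β • (1 : Matrix (Fin n) (Fin n) ℂ) := by
      calc A 1 = A 1 * c * c⁻¹ := by
              rw [Matrix.mul_assoc, Matrix.mul_nonsing_inv _ hu, Matrix.mul_one]
        _ = (c * A 1 + β • c) * c⁻¹ := by rw [h2, sub_add_cancel]
        _ = c * A 1 * c⁻¹ + β • (c * c⁻¹) := by rw [Matrix.add_mul, Matrix.smul_mul]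
        _ = c * A 1 * c⁻¹ + β • 1 := by rw [Matrix.mul_nonsing_inv _ hu]
    have ht := congrArg Matrix.trace key
    rw [Matrix.trace_add, Matrix.trace_mul_cycle, Matrix.nonsing_inv_mul _ hu, Matrix.one_mul,
      Matrix.trace_smul, Matrix.trace_one, Fintype.card_fin, smul_eq_mul] at ht
    have h0 : β * (n : ℂ) = 0 := by linear_combination -ht
    rcases mul_eq_zero.1 h0 with h | h
    · exact hβ h
    · exact hn (by exact_mod_cast h)
  obtain ⟨v, hv0, hcv⟩ := Matrix.exists_mulVec_eq_zero_iff.2 hdet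
  -- (ii) the generators preserve `ker c`
  have hgen : ∀ (x : Fin 2) (u : Fin n → ℂ), c *ᵥ u = 0 → c *ᵥ (A x *ᵥ u) = 0 := by
    refine Fin.forall_fin_two.2 ⟨fun u hu => ?_, fun u hu => ?_⟩
    · rw [ha, Matrix.add_mulVec, Matrix.smul_mulVec, Matrix.smul_mulVec,
        Matrix.one_mulVec, hu, smul_zero, add_zero, Matrix.mulVec_smul, hu, smul_zero]
    · rw [Matrix.mulVec_mulVec, h2, Matrix.sub_mulVec, ← Matrix.mulVec_mulVec, hu,
        Matrix.mulVec_zero, Matrix.smul_mulVec, hu, smul_zero, sub_zero]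
  -- hence so does every matrix
  have hinv : ∀ (X : Matrix (Fin n) (Fin n) ℂ) (u : Fin n → ℂ), c *ᵥ u = 0 →
      c *ᵥ (X *ᵥ u) = 0 := by
    intro X
    have hX : X ∈ Submodule.span ℂ {M : Matrix (Fin n) (Fin n) ℂ |
        ∃ w : List (Fin 2), w.length ≤ d ∧ (w.map A).prod = M} := by
      rw [hspan]; exact Submodule.mem_top
    induction hX using Submodule.span_induction with
    | mem X hX =>
      obtain ⟨w, -, rfl⟩ := hX
      induction w with
      | nil => intro u hu; simpa using hu
      | cons x w ih =>
        intro u hu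
        simp only [List.map_cons, List.prod_cons, ← Matrix.mulVec_mulVec]
        exact hgen x _ (ih u hu)
    | zero => intro u hu; simp
    | add X Y _ _ hX hY =>
      intro u hu
      rw [Matrix.add_mulVec, Matrix.mulVec_add, hX u hu, hY u hu, add_zero]
    | smul r X _ hX =>
      intro u hu
      rw [Matrix.smul_mulVec, Matrix.mulVec_smul, hX u hu, smul_zero]
  -- (iii) but `M_n` moves `v ∈ ker c ∖ 0` out of `ker c ≠ ℂⁿ`
  obtain ⟨u, hu⟩ : ∃ u : Fin n → ℂ, c *ᵥ u ≠ 0 := by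
    by_contra h
    push Not at h
    apply hc
    ext i j
    have := congrFun (h (Pi.single j 1)) i
    rw [Matrix.mulVec_single_one] at this
    simpa using this
  obtain ⟨j, hj⟩ : ∃ j, v j ≠ 0 := by
    by_contra h
    push Not at h
    exact hv0 (funext h)
  have key := hinv (Matrix.vecMulVec u (Pi.single j 1)) v hcv
  have e : Matrix.vecMulVec u (Pi.single j (1 : ℂ)) *ᵥ v = v j • u := by
    ext i
    simp [Matrix.mulVec, dotProduct, Matrix.vecMulVec_apply, Pi.single_apply, mul_comm]
  rw [e, Matrix.mulVec_smul] at key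
  exact smul_ne_zero hj hu key

/-- The window hypothesis in `Finsupp` form. [folklore] -/
theorem masq_finsupp
    (hmasq : ∀ (T : Finset (List (Fin 2))) (c : List (Fin 2) → ℂ), (∀ w ∈ T, w.length ≤ 2 * d) →
      (∀ B : Fin 2 → Matrix (Fin 2) (Fin 2) ℂ, (∑ w ∈ T, c w • (w.map B).prod) = 0) →
      (∑ w ∈ T, c w • (w.map A).prod) = 0)
    (f : List (Fin 2) →₀ ℂ) (hlen : ∀ w ∈ f.support, w.length ≤ 2 * d)
    (hvan : ∀ B : Fin 2 → Matrix (Fin 2) (Fin 2) ℂ,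
      Finsupp.linearCombination ℂ (fun w : List (Fin 2) => (w.map B).prod) f = 0) :
    Finsupp.linearCombination ℂ (fun w : List (Fin 2) => (w.map A).prod) f = 0 := by
  have := hmasq f.support f hlen (fun B => by
    simpa [Finsupp.linearCombination_apply, Finsupp.sum] using hvan B)
  simpa [Finsupp.linearCombination_apply, Finsupp.sum] using this

/-- On `M₂(ℂ)` the square of a commutator is scalar (Cayley–Hamilton for a traceless `2 × 2`
matrix). [folklore] -/
theorem commutator_sq_two (U Y : Matrix (Fin 2) (Fin 2) ℂ) :
    ∃ s : ℂ, (U * Y - Y * U) * (U * Y - Y * U) = s • (1 : Matrix (Fin 2) (Fin 2) ℂ) := by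
  have htr : (U * Y - Y * U) 0 0 + (U * Y - Y * U) 1 1 = 0 := by
    simp [Matrix.mul_apply, Fin.sum_univ_two]; ring
  generalize U * Y - Y * U = C at htr ⊢
  refine ⟨C 0 0 * C 0 0 + C 0 1 * C 1 0, ?_⟩
  ext i j
  fin_cases i <;> fin_cases j <;> simp [Matrix.mul_apply, Fin.sum_univ_two]
  · linear_combination (C 0 1) * htr
  · linear_combination (C 1 0) * htr
  · linear_combination (C 1 1 - C 0 0) * htr

/-- Hall: `[X,Y][Z,Y] + [Z,Y][X,Y]` is central in `M₂(ℂ)` (polarise `commutator_sq_two`).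
[folklore] -/
theorem hall_central_two (X Z Y T : Matrix (Fin 2) (Fin 2) ℂ) :
    ((X * Y - Y * X) * (Z * Y - Y * Z) + (Z * Y - Y * Z) * (X * Y - Y * X)) * T =
      T * ((X * Y - Y * X) * (Z * Y - Y * Z) + (Z * Y - Y * Z) * (X * Y - Y * X)) := by
  obtain ⟨s1, h1⟩ := commutator_sq_two X Y
  obtain ⟨s2, h2⟩ := commutator_sq_two Z Y
  obtain ⟨s3, h3⟩ := commutator_sq_two (X + Z) Y
  have e : (X * Y - Y * X) * (Z * Y - Y * Z) + (Z * Y - Y * Z) * (X * Y - Y * X) =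
      ((X + Z) * Y - Y * (X + Z)) * ((X + Z) * Y - Y * (X + Z))
        - (X * Y - Y * X) * (X * Y - Y * X) - (Z * Y - Y * Z) * (Z * Y - Y * Z) := by
    noncomm_ring
  rw [e, h1, h2, h3]
  simp [Matrix.sub_mul, Matrix.mul_sub]

/-- The level-one consequence of the window (`d ≥ 4`): for every word `w` of length `≤ d` and each
generator `A i`, `[w(A),a][b,a] + [b,a][w(A),a]` commutes with `A i` (`a = A 0`, `b = A 1`).
[folklore] -/
theorem hall_window (hd : 4 ≤ d)
    (hmasq : ∀ (T : Finset (List (Fin 2))) (c : List (Fin 2) → ℂ), (∀ w ∈ T, w.length ≤ 2 * d) →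
      (∀ B : Fin 2 → Matrix (Fin 2) (Fin 2) ℂ, (∑ w ∈ T, c w • (w.map B).prod) = 0) →
      (∑ w ∈ T, c w • (w.map A).prod) = 0)
    (w : List (Fin 2)) (hw : w.length ≤ d) (i : Fin 2) :
    (((w.map A).prod * A 0 - A 0 * (w.map A).prod) * (A 1 * A 0 - A 0 * A 1)
        + (A 1 * A 0 - A 0 * A 1) * ((w.map A).prod * A 0 - A 0 * (w.map A).prod)) * A i =
      A i * (((w.map A).prod * A 0 - A 0 * (w.map A).prod) * (A 1 * A 0 - A 0 * A 1)
        + (A 1 * A 0 - A 0 * A 1) * ((w.map A).prod * A 0 - A 0 * (w.map A).prod)) := by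
  -- the formal polynomial `[[w,x₀][x₁,x₀] + [x₁,x₀][w,x₀], xᵢ]` as a `Finsupp` on words
  let f : List (Fin 2) →₀ ℂ :=
      Finsupp.single (w ++ [0, 1, 0, i]) 1 - Finsupp.single (w ++ [0, 0, 1, i]) 1
    - Finsupp.single (0 :: (w ++ [1, 0, i])) 1 + Finsupp.single (0 :: (w ++ [0, 1, i])) 1
    + Finsupp.single (1 :: 0 :: (w ++ [0, i])) 1 - Finsupp.single (1 :: 0 :: 0 :: (w ++ [i])) 1
    - Finsupp.single (0 :: 1 :: (w ++ [0, i])) 1 + Finsupp.single (0 :: 1 :: 0 :: (w ++ [i])) 1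
    - Finsupp.single (i :: (w ++ [0, 1, 0])) 1 + Finsupp.single (i :: (w ++ [0, 0, 1])) 1
    + Finsupp.single (i :: 0 :: (w ++ [1, 0])) 1 - Finsupp.single (i :: 0 :: (w ++ [0, 1])) 1
    - Finsupp.single (i :: 1 :: 0 :: (w ++ [0])) 1 + Finsupp.single (i :: 1 :: 0 :: 0 :: w) 1
    + Finsupp.single (i :: 0 :: 1 :: (w ++ [0])) 1 - Finsupp.single (i :: 0 :: 1 :: 0 :: w) 1
  have hev : ∀ {m : ℕ} (E : Fin 2 → Matrix (Fin m) (Fin m) ℂ),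
      Finsupp.linearCombination ℂ (fun u : List (Fin 2) => (u.map E).prod) f =
        (((w.map E).prod * E 0 - E 0 * (w.map E).prod) * (E 1 * E 0 - E 0 * E 1)
          + (E 1 * E 0 - E 0 * E 1) * ((w.map E).prod * E 0 - E 0 * (w.map E).prod)) * E i
        - E i * (((w.map E).prod * E 0 - E 0 * (w.map E).prod) * (E 1 * E 0 - E 0 * E 1)
          + (E 1 * E 0 - E 0 * E 1) * ((w.map E).prod * E 0 - E 0 * (w.map E).prod)) := by
    intro m E
    simp only [f, map_add, map_sub, Finsupp.linearCombination_single, one_smul, List.map_append,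
      List.map_cons, List.map_nil, List.prod_append, List.prod_cons, List.prod_nil, Matrix.mul_one]
    noncomm_ring
  have hz : ∀ v : List (Fin 2), v.length = w.length + 4 → ∀ u : List (Fin 2),
      u.length ≠ w.length + 4 → Finsupp.single v (1 : ℂ) u = 0 := by
    intro v hv u hu
    exact Finsupp.single_eq_of_ne (by rintro rfl; exact hu hv)
  have hlen : ∀ u ∈ f.support, u.length ≤ 2 * d := by
    intro u hu
    by_cases hl : u.length = w.length + 4
    · omega
    · exfalso
      apply Finsupp.mem_support_iff.1 hu
      simp [f, hz _ _ u hl]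
  have hvan : ∀ B : Fin 2 → Matrix (Fin 2) (Fin 2) ℂ,
      Finsupp.linearCombination ℂ (fun u : List (Fin 2) => (u.map B).prod) f = 0 := by
    intro B
    rw [hev B, sub_eq_zero]
    exact hall_central_two _ _ _ _
  have := masq_finsupp hmasq f hlen hvan
  rwa [hev A, sub_eq_zero] at this

/-- Entry formula for `P E_{st} Q`. [folklore] -/
theorem sandwich_single_apply (P Q : Matrix (Fin n) (Fin n) ℂ) (s t i l : Fin n) :
    (P * Matrix.single s t (1 : ℂ) * Q) i l = P i s * Q t l := by
  rw [Matrix.single_eq_single_vecMulVec_single, Matrix.mul_vecMulVec, Matrix.vecMulVec_mul,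
    Matrix.vecMulVec_apply, Matrix.mulVec_single_one, Matrix.single_one_vecMul]
  rfl

/-- Tensor vanishing: an operator identity `Σ ± Pⱼ X Qⱼ = 0` on `M_n` kills `Σ ± α(Pⱼ) γ(Qⱼ)` for
all linear functionals `α, γ` (`M_n ⊗ M_nᵒᵖ ≅ End M_n`, in coordinates). [folklore] -/
theorem tensor_vanish4 (P₁ Q₁ P₂ Q₂ P₃ Q₃ P₄ Q₄ : Matrix (Fin n) (Fin n) ℂ)
    (h : ∀ X : Matrix (Fin n) (Fin n) ℂ,
      P₁ * X * Q₁ - P₂ * X * Q₂ + P₃ * X * Q₃ - P₄ * X * Q₄ = 0)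
    (α γ : Matrix (Fin n) (Fin n) ℂ →ₗ[ℂ] ℂ) :
    α P₁ * γ Q₁ - α P₂ * γ Q₂ + α P₃ * γ Q₃ - α P₄ * γ Q₄ = 0 := by
  have key : ∀ i s t l : Fin n,
      P₁ i s * Q₁ t l - P₂ i s * Q₂ t l + P₃ i s * Q₃ t l - P₄ i s * Q₄ t l = 0 := by
    intro i s t l
    have := congrFun (congrFun (h (Matrix.single s t 1)) i) l
    simpa only [Matrix.sub_apply, Matrix.add_apply, sandwich_single_apply,
      Matrix.zero_apply] using this
  have step1 : ∀ t l : Fin n, Q₁ t l • P₁ - Q₂ t l • P₂ + Q₃ t l • P₃ - Q₄ t l • P₄ = 0 := by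
    intro t l
    ext i s
    simp only [Matrix.sub_apply, Matrix.add_apply, Matrix.smul_apply, smul_eq_mul,
      Matrix.zero_apply]
    linear_combination key i s t l
  have step2 : α P₁ • Q₁ - α P₂ • Q₂ + α P₃ • Q₃ - α P₄ • Q₄ = 0 := by
    ext t l
    simp only [Matrix.sub_apply, Matrix.add_apply, Matrix.smul_apply, smul_eq_mul,
      Matrix.zero_apply]
    have := congrArg α (step1 t l)
    simp only [map_sub, map_add, map_smul, smul_eq_mul, map_zero] at this
    linear_combination this
  have := congrArg γ step2
  simp only [map_sub, map_add, map_smul, smul_eq_mul, map_zero] at this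
  linear_combination this

end LongMasqueradeNeg

end Summit.MatrixMultiplication.MatrixMultiplication.Theorems
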